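import Summits.QuantumFields.BalabanUV.T4Continuum.Support.NE7K1LinWalkLineHcomm
import Summits.QuantumFields.BalabanUV.T4Continuum.Support.NE7K1LinWalkFineOp

/-!
# NE7K1LinWalkLineWalk — row NE7 (node U5), candidate route HOM, path H1L, cell K1-lin(s): THE RANDOM-WALK EXPANSION OF THE
# TWO-CUTOFF LINE AT U = 1, UNIFORMLY IN `s ∈ [0,1]` AND IN THE MESH — B4 (2.12)–(2.13) ∕ (2.22) run on the ψ-rescaled extended
# operator `𝒫♮(s)` and read off on its coarse block `(𝒫♮(s))⁻¹|_{coarse} = (twoCutoffLine s)⁻¹`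

Lineage `b2b-balaban-t4-ne7-p2` (CRUX PROVER NE7 #2), generation 69; series (RW) file 14 = the ASSEMBLY for the LINE (§ gen 68 (4)):
`NE7K1LinWalkLineHcomm.comm_extLine_sq_le` ((H-comm) for `𝒫♮(s)`), `NE7K1LinWalkLine.extLine_coercive ∕ extLine_inv_inl_inl` (g68),
`NE7K1LinWalkExpansion.hasSum_walk_expansion ∕ inv_entry_decay` (g68, over `B4RandomWalk213` BY NAME), the cut-offs and regions of
`NE7K1LinWalkCubes ∕ …Box` (g68) lifted to `Idx = coarse sites ⊕ (coarse site × non-zero offset)` through `site`.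
THE INSTANCE: `R′` a union of `nL`-blocks whose coarse labels form the aligned box `Π_μ[0,(2K_μ+1)Mn)` (mesh `1∕n` on run A's lattice,
cube scale `M ≥ 3` blocks), `a > 0`, `s ∈ [0,1]`; labels `J ∈ Π_μ{0..K_μ}` (`NE7K1LinWalkFineOp.Lab`), cut-offs `cut (Mn) J ∘ site`,
regions `{c : site c ∈ region (Mn) n J}` and their indicators.
* §1 `lineAlpha2 = 384(d+1)(1+L³)∕M²`, `lineBeta2 = 6144(d+1)²(1+L²)∕M⁴ + 192a²(d+1)²∕M² + 8192(d+1)⁴L⁴(L^{−(d+1)} + 1)∕M²`,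
  `lineSigma = min(min(2,a)∕2, L^{−(d+1)})`, `lineTau = √(lineAlpha2∕σ′ + lineBeta2∕σ′²)`, `σ′ = min(lineSigma,1)` — NO `n`, NO `s`;
  **`hcomm_line`**: (H-comm) for `𝒫♮(s)` with these constants (file 13 at `ℓ₁ = 4∕(Mn)`, `ℓ₂ = 32(d+1)∕(Mn)²`, `ℓ₃ = 4(d+1)n∕(Mn)`; the one
  `n`-dependent term `8192(d+1)⁴L⁴∕(M²n²)` is bounded by its `n = 1` value).
* §2 the cube system on `Idx`: range `≤ n` in coarse units (`extLine_ne_zero_close`), `CutoffOn`, partition of unity, disjointness,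
  overlap ∕ covering numbers `≤ 3^{d+1}` — the hypotheses of the abstract expansion, DISCHARGED.
* §3 **`hasSum_extLine_walk`**: for `3^{d+1}·lineTau < 1` the random-walk expansion of `(𝒫♮(s))⁻¹` over the `M`-cubes CONVERGES for EVERY
  `s ∈ [0,1]`; **`twoCutoffLine_inv_entry_decay`**: for coarse sites with `|x_μ − y_μ| ≥ (2N+3)Mn + n` in some coordinate (`N ≥ 1`),
  `|(twoCutoffLine s)⁻¹(x,y)| ≤ 3^{d+1}σ′⁻¹·lineTau·3^{d+1}(3^{d+1}lineTau)^{N−1}∕(1 − 3^{d+1}lineTau)` — the K1-lin(s) line's propagator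
  decays geometrically across `M`-cubes with constants FREE OF `s` AND OF THE MESH (one `M₀(d,L,a)` for the whole line).

HONEST FRAMING: [folklore] assembly at the Gaussian `A = 0` level, U = 1 (two cut-offs), ONE scale, aligned boxes, crude explicit constants
(not optimised); no background field, no covariant derivative, no multi-scale factor `M^{−½|ω|}`, no Hölder norms (B4 §3), no `δG`
clause; nothing of Bałaban's asserted beyond the dictionary; no `sorry`.  Census only («template application»: random-walk half IN KERNEL
for the s = 0 endpoint AND for the two-cutoff line uniformly in s; regularity half PARAMETRIC; licence item untouched); NO letter ∕ tag ∕
size of NE7 moves; NE7 NOT PRINTED ∕ NOT PROVED; spine 0∕9; FIXED FINITE T⁴, rung (B)+1; NOT infinite volume, NOT mass gap, NOT Clay.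
HONEST DEPENDENCY: continuum YM on T⁴ ⇐ BetaPertH ∧ nine spine estimates (0/9 proved); BetaPertH ⇐ (D1) ∧ (D4) ∧ CAP+tail; G-an2-4
gates asym, D1 and NE2/3/4.
-/

noncomputable section

open Finset Matrix
open scoped Matrix.Norms.L2Operator

namespace Summit.QuantumFields.BalabanUV.T4Continuum.NE7K1LinWalkLineWalk

open Literature.MathematicalPhysics.QuantumFieldTheory.Balaban1983to89
open Literature.MathematicalPhysics.QuantumFieldTheory.Balaban1983to89.B4Reflection242
open Literature.MathematicalPhysics.QuantumFieldTheory.Balaban1983to89.B4BoxCov237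
open Literature.MathematicalPhysics.QuantumFieldTheory.Balaban1983to89.B4Lower18
open Literature.MathematicalPhysics.QuantumFieldTheory.Balaban1983to89.Beta.CombesThomasForm (lap lap_apply)
open NE7K1LinSchurLineForm NE7K1LinSchurLineCoords NE7K1LinBlockCoords NE7K1LinSchurLineU1 NE7K1LinSchurLineU1Sharp NE7K1LinTwoRunKit
  NE7K1LinTwoRunUpper NE7K1LinWalkParametrix NE7K1LinWalkSmallness NE7K1LinWalkExpansion NE7K1LinWalkCubes NE7K1LinWalkBox
  NE7K1LinWalkFineOp NE7K1LinWalkLine NE7K1LinWalkLineCoarse NE7K1LinWalkLineEntries NE7K1LinWalkLineBlocks NE7K1LinWalkLineHcomm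

variable {d : ℕ}

/-! ### §1 The constants of the line and its (H-comm) -/

/-- `α♮ = 384(d+1)(1+L³)∕M²`. [folklore] -/
def lineAlpha2 (d L M : ℕ) : ℝ := 384 * ((d : ℝ) + 1) * (1 + (L : ℝ) ^ 3) / (M : ℝ) ^ 2

/-- `β♮ = 6144(d+1)²(1+L²)∕M⁴ + 192a²(d+1)²∕M² + 8192(d+1)⁴L⁴(L^{−(d+1)} + 1)∕M²`. [folklore] -/
def lineBeta2 (d L M : ℕ) (a : ℝ) : ℝ :=
  6144 * ((d : ℝ) + 1) ^ 2 * (1 + (L : ℝ) ^ 2) / (M : ℝ) ^ 4 + 192 * a ^ 2 * ((d : ℝ) + 1) ^ 2 / (M : ℝ) ^ 2 +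
    8192 * ((d : ℝ) + 1) ^ 4 * (L : ℝ) ^ 4 * (1 / (L : ℝ) ^ (d + 1) + 1) / (M : ℝ) ^ 2

/-- the line's coercivity constant `σ♮ = min(min(2,a)∕2, L^{−(d+1)})` (`NE7K1LinWalkLine.extLine_coercive`). [folklore] -/
def lineSigma (d L : ℕ) (a : ℝ) : ℝ := min (min 2 a / 2) (1 / (L : ℝ) ^ (d + 1))

/-- the line's walk parameter `τ♮ = √(α♮∕σ′ + β♮∕σ′²)`, `σ′ = min(σ♮,1)`. [folklore] -/
def lineTau (d L M : ℕ) (a : ℝ) : ℝ :=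
  Real.sqrt (lineAlpha2 d L M / min (lineSigma d L a) 1 + lineBeta2 d L M a / (min (lineSigma d L a) 1) ^ 2)

section Instance

variable {n L M : ℕ} [NeZero L] {R' : Finset (Fin (d + 1) → ℤ)} (K : Fin (d + 1) → ℕ) (hn : 1 ≤ n) (hM : 3 ≤ M)
  (hR' : IsBlockUnion (n * L) R') (hbox : R'.image (blk L) = boxDom fun μ => (2 * K μ + 1) * (M * n)) {a : ℝ} (ha : 0 < a)
  {s : ℝ} (hs0 : 0 ≤ s) (hs1 : s ≤ 1)

/-- neighbour sums do not see which finite set the summation variable is typed in. [folklore] -/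
theorem sum_filter_nbrs_transport {R₁ R₂ : Finset (Fin (d + 1) → ℤ)} (h : R₁ = R₂) (F : (Fin (d + 1) → ℤ) → (Fin (d + 1) → ℤ) → ℝ)
    (x : Fin (d + 1) → ℤ) :
    ∑ y ∈ univ.filter (fun y : ↥R₁ => y.1 ∈ nbrs x), F x y.1 = ∑ y ∈ univ.filter (fun y : ↥R₂ => y.1 ∈ nbrs x), F x y.1 := by
  subst h; rfl

include hn hM in
omit [NeZero L] in
/-- the `α` of file 13 at `ℓ₁ = 4∕(Mn)` IS `α♮` (every `n` cancels). [folklore] -/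
theorem alpha_line_eq :
    2 * (12 * ((d : ℝ) + 1) * (n : ℝ) ^ 2 * (4 / ((M * n : ℕ) : ℝ)) ^ 2 + (L : ℝ) ^ 2 * (12 * ((d : ℝ) + 1) * L * (n : ℝ) ^ 2 * (4 / ((M * n : ℕ) : ℝ)) ^ 2)) =
      lineAlpha2 d L M := by
  have hn0 : (n : ℝ) ≠ 0 := Nat.cast_ne_zero.2 (by omega)
  have hM0 : (M : ℝ) ≠ 0 := Nat.cast_ne_zero.2 (by omega)
  have hWr : ((M * n : ℕ) : ℝ) = (M : ℝ) * n := by push_cast; ring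
  rw [hWr, lineAlpha2]; field_simp; ring

include hn hM in
/-- the `β` of file 13 at `ℓ₁ = 4∕(Mn)`, `ℓ₂ = 32(d+1)∕(Mn)²`, `ℓ₃ = 4(d+1)n∕(Mn)` is AT MOST `β♮` (every `n` cancels but one term
`8192(d+1)⁴L⁴∕(M²n²) ≤ 8192(d+1)⁴L⁴∕M²`). [folklore] -/
theorem beta_line_le (a : ℝ) :
    2 * (3 * (((n : ℝ) ^ 2 * (32 * ((d : ℝ) + 1) / ((M * n : ℕ) : ℝ) ^ 2)) ^ 2 + a ^ 2 * (4 * ((d : ℝ) + 1) * n / ((M * n : ℕ) : ℝ)) ^ 2) + 3 * (((L : ℝ) * (n : ℝ) ^ 2 * (32 * ((d : ℝ) + 1) / ((M * n : ℕ) : ℝ) ^ 2)) ^ 2 + a ^ 2 * (4 * ((d : ℝ) + 1) * n / ((M * n : ℕ) : ℝ)) ^ 2)) +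
          2 * ((4 / ((M * n : ℕ) : ℝ)) * (8 * ((d : ℝ) + 1) * ((n : ℝ) * L) ^ 2 / (L : ℝ) ^ (d + 1))) ^ 2 *
            ((1 / (n : ℝ)) ^ 2 * (2 * ((d : ℝ) + 1) * (L : ℝ) ^ (d + 1) * (2 * ((d : ℝ) + 1))) +
              ((1 / (n : ℝ)) ^ 2) ^ 2 * (2 * ((d : ℝ) + 1) * (L : ℝ) ^ (d + 1) * (2 * ((d : ℝ) + 1) * (L : ℝ) ^ (d + 1)))) ≤
      lineBeta2 d L M a := by
  have hn0 : (n : ℝ) ≠ 0 := Nat.cast_ne_zero.2 (by omega)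
  have hM0' : (0 : ℝ) < M := Nat.cast_pos.2 (by omega)
  have hM0 : (M : ℝ) ≠ 0 := hM0'.ne'
  have hL0 : (L : ℝ) ≠ 0 := Nat.cast_ne_zero.2 (NeZero.ne L)
  have hLpow : ((L : ℝ) ^ (d + 1)) ≠ 0 := pow_ne_zero _ hL0
  have hWr : ((M * n : ℕ) : ℝ) = (M : ℝ) * n := by push_cast; ring
  have e : 2 * (3 * (((n : ℝ) ^ 2 * (32 * ((d : ℝ) + 1) / ((M * n : ℕ) : ℝ) ^ 2)) ^ 2 + a ^ 2 * (4 * ((d : ℝ) + 1) * n / ((M * n : ℕ) : ℝ)) ^ 2) + 3 * (((L : ℝ) * (n : ℝ) ^ 2 * (32 * ((d : ℝ) + 1) / ((M * n : ℕ) : ℝ) ^ 2)) ^ 2 + a ^ 2 * (4 * ((d : ℝ) + 1) * n / ((M * n : ℕ) : ℝ)) ^ 2)) +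
          2 * ((4 / ((M * n : ℕ) : ℝ)) * (8 * ((d : ℝ) + 1) * ((n : ℝ) * L) ^ 2 / (L : ℝ) ^ (d + 1))) ^ 2 *
            ((1 / (n : ℝ)) ^ 2 * (2 * ((d : ℝ) + 1) * (L : ℝ) ^ (d + 1) * (2 * ((d : ℝ) + 1))) +
              ((1 / (n : ℝ)) ^ 2) ^ 2 * (2 * ((d : ℝ) + 1) * (L : ℝ) ^ (d + 1) * (2 * ((d : ℝ) + 1) * (L : ℝ) ^ (d + 1)))) =
      6144 * ((d : ℝ) + 1) ^ 2 * (1 + (L : ℝ) ^ 2) / (M : ℝ) ^ 4 + 192 * a ^ 2 * ((d : ℝ) + 1) ^ 2 / (M : ℝ) ^ 2 +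
        8192 * ((d : ℝ) + 1) ^ 4 * (L : ℝ) ^ 4 / ((M : ℝ) ^ 2 * (L : ℝ) ^ (d + 1)) +
          8192 * ((d : ℝ) + 1) ^ 4 * (L : ℝ) ^ 4 / ((M : ℝ) ^ 2 * (n : ℝ) ^ 2) := by
    rw [hWr]; field_simp; ring
  rw [e, lineBeta2]
  have h1 : 8192 * ((d : ℝ) + 1) ^ 4 * (L : ℝ) ^ 4 / ((M : ℝ) ^ 2 * (n : ℝ) ^ 2) ≤ 8192 * ((d : ℝ) + 1) ^ 4 * (L : ℝ) ^ 4 / (M : ℝ) ^ 2 := by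
    rw [div_le_div_iff_of_pos_left (by positivity) (by positivity) (by positivity)]
    have hn1 : (1 : ℝ) ≤ (n : ℝ) ^ 2 := one_le_pow₀ (by exact_mod_cast hn)
    nlinarith [sq_nonneg (M : ℝ)]
  have e2 : 8192 * ((d : ℝ) + 1) ^ 4 * (L : ℝ) ^ 4 * (1 / (L : ℝ) ^ (d + 1) + 1) / (M : ℝ) ^ 2 =
      8192 * ((d : ℝ) + 1) ^ 4 * (L : ℝ) ^ 4 / ((M : ℝ) ^ 2 * (L : ℝ) ^ (d + 1)) + 8192 * ((d : ℝ) + 1) ^ 4 * (L : ℝ) ^ 4 / (M : ℝ) ^ 2 := by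
    field_simp
  rw [e2]; linarith

include hn hM hR' hbox ha hs0 hs1 in
/-- **(H-comm) FOR `𝒫♮(s)` WITH THE LINE'S CONSTANTS**: `‖[diag(cut_J∘site), 𝒫♮(s)]w‖² ≤ α♮⟨w,𝒫♮(s)w⟩ + β♮‖w‖²` — file 13 at
`ℓ₁ = 4∕(Mn)`, `ℓ₂ = 32(d+1)∕(Mn)²`, `ℓ₃ = 4(d+1)n∕(Mn)` (`NE7K1LinWalkCubes`: bond Lipschitz, `NE7K1LinWalkBox`: Neumann second difference
on the aligned box, `n`-block oscillation). [folklore] -/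
theorem hcomm_line (J : Lab K) (w : Idx L R' → ℝ) :
    comm (fun c : Idx L R' => cut (M * n) J.1 (site c).1) (extLine (isBlockUnion_fine hR') n a s) *ᵥ w ⬝ᵥ
        comm (fun c : Idx L R' => cut (M * n) J.1 (site c).1) (extLine (isBlockUnion_fine hR') n a s) *ᵥ w ≤
      lineAlpha2 d L M * (w ⬝ᵥ (extLine (isBlockUnion_fine hR') n a s) *ᵥ w) + lineBeta2 d L M a * (w ⬝ᵥ w) := by
  obtain ⟨hW, hW2, -⟩ := scale_facts hn hM
  have h := comm_extLine_sq_le hn hR' ha hs0 hs1 (fun b : ↥(R'.image (blk L)) => cut (M * n) J.1 b.1)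
    (ℓ₁ := 4 / ((M * n : ℕ) : ℝ)) (ℓ₂ := 32 * ((d : ℝ) + 1) / ((M * n : ℕ) : ℝ) ^ 2) (ℓ₃ := 4 * ((d : ℝ) + 1) * n / ((M * n : ℕ) : ℝ))
    (by positivity) (by positivity)
    (fun x y hxy => abs_cut_sub_cut_of_mem_nbrs hW J.1 hxy)
    (fun x => by
      have hx : x.1 ∈ boxDom (fun μ => (2 * K μ + 1) * (M * n)) := by rw [← hbox]; exact x.2
      rw [sum_filter_nbrs_transport hbox (fun u v => cut (M * n) J.1 u - cut (M * n) J.1 v) x.1]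
      exact abs_sum_nbrs_cut_sub_le hW2 K J.1 ⟨x.1, hx⟩)
    (fun x y hxy => abs_cut_sub_cut_of_blk_eq hW hn J.1 hxy) w
  have hform : 0 ≤ w ⬝ᵥ (extLine (isBlockUnion_fine hR') n a s) *ᵥ w :=
    le_trans (mul_nonneg (le_min (by positivity) (by positivity)) (Finset.sum_nonneg fun i _ => mul_self_nonneg _))
      (extLine_coercive hn hR' ha hs0 hs1 w)
  have hww : 0 ≤ w ⬝ᵥ w := Finset.sum_nonneg fun i _ => mul_self_nonneg _
  refine h.trans ?_
  exact add_le_add (mul_le_mul_of_nonneg_right (alpha_line_eq hn hM).le hform)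
    (mul_le_mul_of_nonneg_right (beta_line_le hn hM a) hww)

/-! ### §2 The cube system on the coordinate index -/

omit [NeZero L] in
/-- neighbours are at coordinate distance `≤ 1`. [folklore] -/
theorem abs_sub_le_one_of_mem_nbrs {x y : Fin (d + 1) → ℤ} (h : y ∈ nbrs x) (μ : Fin (d + 1)) : |x μ - y μ| ≤ 1 := by
  obtain ⟨ν, hν | hν⟩ := mem_nbrs.1 h
  · rw [hν]; by_cases hμν : μ = ν
    · subst hμν; simp
    · simp [hμν]
  · rw [hν]; by_cases hμν : μ = ν
    · subst hμν; simp
    · simp [hμν]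

include hn hR' in
/-- **THE RANGE OF `𝒫♮(s)` IN COARSE UNITS IS `≤ n`**: a nonzero entry `𝒫♮(s)(c,c′)` forces `|site c − site c′|_μ ≤ n` for every `μ`
(the coarse block: range `n` of `P_A` and of `(H_B)₁₁ = P_A + (L−1)lap`; a fluctuation label: adjacent sites, file 11). [folklore] -/
theorem extLine_ne_zero_close {c c' : Idx L R'} (h : extLine (isBlockUnion_fine hR') n a s c c' ≠ 0) (μ : Fin (d + 1)) :
    |(site c).1 μ - (site c').1 μ| ≤ n := by
  have hRc : IsBlockUnion n (R'.image (blk L)) := isBlockUnion_coarse NeZero.one_le hR'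
  have hn1 : (1 : ℤ) ≤ n := by exact_mod_cast hn
  -- adjacency or equality of the sites gives distance `≤ 1 ≤ n`
  have hclose : ∀ b b' : ↥(R'.image (blk L)), (b = b' ∨ b'.1 ∈ nbrs b.1) → |b.1 μ - b'.1 μ| ≤ n := by
    rintro b b' (rfl | hnb)
    · simp
    · exact (abs_sub_le_one_of_mem_nbrs hnb μ).trans hn1
  rcases c with b | p <;> rcases c' with b' | q
  · -- coarse-coarse: `(1−s)P_A + s(H_B)₁₁`
    rw [extLine_apply_inl_inl] at h
    simp only [site]
    by_cases hA : runA n L a R' b b' ≠ 0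
    · exact fineOpR_ne_zero_close hn hA μ
    · push Not at hA
      rw [hA, mul_zero, zero_add] at h
      have hB : runB (isBlockUnion_fine hR') n a (Sum.inl b) (Sum.inl b') ≠ 0 := right_ne_zero_of_mul h
      have hB' : (runB (isBlockUnion_fine hR') n a).toBlocks₁₁ b b' ≠ 0 := hB
      rw [runB_toBlocks₁₁_eq hn hR' a, Matrix.add_apply, Matrix.smul_apply, smul_eq_mul] at hB'
      have hlap : lap (adjC n (R'.image (blk L))) b b' ≠ 0 := by
        intro h0; apply hB'; rw [show runA n L a R' b b' = 0 from hA, h0, mul_zero, add_zero]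
      refine hclose b b' ?_
      by_cases hbb : b = b'
      · exact Or.inl hbb
      · right
        rw [lap_apply, if_neg hbb, zero_sub, neg_ne_zero] at hlap
        by_contra hnb
        exact hlap (if_neg hnb)
  · rw [extLine_apply_inl_inr] at h
    have hB : runB (isBlockUnion_fine hR') n a (Sum.inl b) (Sum.inr q) ≠ 0 := right_ne_zero_of_mul (right_ne_zero_of_mul h)
    refine hclose (site (Sum.inl b)) q.1 ?_
    by_cases he : site (Sum.inl b : Idx L R') = q.1
    · exact Or.inl he
    · exact Or.inr (mem_nbrs_of_runB_inr_ne_zero hn hR' a hB he)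
  · rw [extLine_apply_inr_inl] at h
    have hB : runB (isBlockUnion_fine hR') n a (Sum.inr p) (Sum.inl b') ≠ 0 := right_ne_zero_of_mul (right_ne_zero_of_mul h)
    by_cases he : p.1 = site (Sum.inl b' : Idx L R')
    · exact hclose _ _ (Or.inl he)
    · exact hclose _ _ (Or.inr (mem_nbrs_of_runB_inr_ne_zero' hn hR' a hB he))
  · rw [extLine_apply_inr_inr] at h
    have hB : runB (isBlockUnion_fine hR') n a (Sum.inr p) (Sum.inr q) ≠ 0 := right_ne_zero_of_mul h
    refine hclose (site (Sum.inr p)) q.1 ?_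
    by_cases he : site (Sum.inr p : Idx L R') = q.1
    · exact Or.inl he
    · exact Or.inr (mem_nbrs_of_runB_inr_ne_zero hn hR' a hB he)

include hn hR' in
/-- **THE CUT-OFFS LIVE ON THEIR REGIONS** for `𝒫♮(s)` (both clauses of `CutoffOn`). [folklore] -/
theorem cutoffOn_line (hW : 1 ≤ M * n) (J : Lab K) :
    CutoffOn (extLine (isBlockUnion_fine hR') n a s) (fun c : Idx L R' => cut (M * n) J.1 (site c).1)
      (univ.filter fun c : Idx L R' => site c ∈ region (R'.image (blk L)) (M * n) n J.1) := by
  refine ⟨fun c hc => Finset.mem_filter.2 ⟨Finset.mem_univ _, mem_region_self_of_cut_ne_zero hW hc⟩, fun c c' hc hc' => ?_⟩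
  rw [Finset.mem_filter, not_and] at hc'
  have hc'' := hc' (Finset.mem_univ _)
  constructor
  · by_contra h
    exact hc'' (mem_region_of_cut_ne_zero hW hc fun μ => extLine_ne_zero_close hn hR' h μ)
  · by_contra h
    exact hc'' (mem_region_of_cut_ne_zero hW hc fun μ => by rw [abs_sub_comm]; exact extLine_ne_zero_close hn hR' h μ)

include hbox in
/-- **PARTITION OF UNITY** `Σ_J Λ_J r_J ≡ 1` on `Idx` (the coarse PoU at `site c`). [folklore] -/
theorem sum_cut_mul_ind_line (hW : 1 ≤ M * n) (c : Idx L R') :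
    ∑ J : Lab K, cut (M * n) J.1 (site c).1 *
      (if c ∈ univ.filter (fun c : Idx L R' => site c ∈ region (R'.image (blk L)) (M * n) n J.1) then (1 : ℝ) else 0) = 1 := by
  have h1 : ∀ J : Lab K, cut (M * n) J.1 (site c).1 *
      (if c ∈ univ.filter (fun c : Idx L R' => site c ∈ region (R'.image (blk L)) (M * n) n J.1) then (1 : ℝ) else 0) =
      cut (M * n) J.1 (site c).1 := by
    intro J
    by_cases h : cut (M * n) J.1 (site c).1 = 0
    · rw [h, zero_mul]
    · rw [if_pos (show c ∈ univ.filter (fun c : Idx L R' => site c ∈ region (R'.image (blk L)) (M * n) n J.1) from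
        Finset.mem_filter.2 ⟨Finset.mem_univ _, mem_region_self_of_cut_ne_zero hW h⟩), mul_one]
  simp_rw [h1]
  have hx : (site c).1 ∈ boxDom (fun μ => (2 * K μ + 1) * (M * n)) := by rw [← hbox]; exact (site c).2
  rw [Finset.sum_coe_sort (labs K) (fun J' => cut (M * n) J' (site c).1)]
  exact sum_cut_eq_one hW K hx

/-- `|Λ_J| ≤ 1`, `|r_J| ≤ 1`, `r_J ≠ 0 ⇒` in the region. [folklore] -/
theorem cut_ind_bounds_line (J : Lab K) (c : Idx L R') :
    |cut (M * n) J.1 (site c).1| ≤ 1 ∧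
      |(if c ∈ univ.filter (fun c : Idx L R' => site c ∈ region (R'.image (blk L)) (M * n) n J.1) then (1 : ℝ) else 0)| ≤ 1 ∧
      ((if c ∈ univ.filter (fun c : Idx L R' => site c ∈ region (R'.image (blk L)) (M * n) n J.1) then (1 : ℝ) else 0) ≠ 0 →
        c ∈ univ.filter (fun c : Idx L R' => site c ∈ region (R'.image (blk L)) (M * n) n J.1)) := by
  refine ⟨abs_cut_le_one _ _ _, ?_, ?_⟩
  · split_ifs <;> simp
  · split_ifs with h
    · exact fun _ => h
    · simp

/-- **DISJOINTNESS** of the lifted regions with non-adjacent labels (`2n < Mn`). [folklore] -/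
theorem disjoint_line (hρ : 2 * n < M * n) {J J' : Lab K} (h : ¬ B4RandomWalk213.cubeAdj (labPos K) J J') :
    Disjoint (univ.filter fun c : Idx L R' => site c ∈ region (R'.image (blk L)) (M * n) n J.1)
      (univ.filter fun c : Idx L R' => site c ∈ region (R'.image (blk L)) (M * n) n J'.1) := by
  rw [Finset.disjoint_left]
  intro c hc hc'
  exact Finset.disjoint_left.1 (disjoint_region (R := R'.image (blk L)) hρ h) (Finset.mem_filter.1 hc).2 (Finset.mem_filter.1 hc').2

set_option synthInstance.maxSize 512 in
/-- **OVERLAP NUMBER `≤ 3^{d+1}`**: regions lying over the coarse regions meet at most `3^{d+1}` of their kind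
(`B4RandomWalk213.card_cubeAdj_le` on the labels; the instance search for `Decidable (¬ Disjoint …)` on the sum type is deep). [folklore] -/
theorem count_overlap_line (hρ : 2 * n < M * n) (S : Lab K → Finset (Idx L R'))
    (hS : ∀ J c, c ∈ S J → site c ∈ region (R'.image (blk L)) (M * n) n J.1) (J : Lab K) :
    (univ.filter fun J' : Lab K => ¬ Disjoint (S J) (S J')).card ≤ 3 ^ (d + 1) := by
  classical
  have hadj := B4RandomWalk213.card_cubeAdj_le (labPos K) (labPos_injective K)
  refine le_trans (Finset.card_le_card fun J' hJ' => ?_) (hadj J)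
  rw [Finset.mem_filter] at hJ' ⊢
  refine ⟨Finset.mem_univ _, ?_⟩
  obtain ⟨c', hc', hc''⟩ := Finset.not_disjoint_iff.mp hJ'.2
  exact labelAdj_of_mem_region hρ (hS J c' hc') (hS J' c' hc'')

/-- **COVERING NUMBERS `≤ 3^{d+1}`**: at most `3^{d+1}` lifted regions (resp. cut-off supports) contain a given coordinate. [folklore] -/
theorem count_cover_line (hW : 1 ≤ M * n) (hρ : 2 * n < M * n) (c : Idx L R') :
    (univ.filter fun J' : Lab K => (if c ∈ univ.filter (fun c : Idx L R' => site c ∈ region (R'.image (blk L)) (M * n) n J'.1)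
        then (1 : ℝ) else 0) ≠ 0).card ≤ 3 ^ (d + 1) ∧
      (univ.filter fun J' : Lab K => cut (M * n) J'.1 (site c).1 ≠ 0).card ≤ 3 ^ (d + 1) := by
  classical
  have hadj := B4RandomWalk213.card_cubeAdj_le (labPos K) (labPos_injective K)
  refine ⟨?_, ?_⟩
  · by_cases hne : (univ.filter fun J' : Lab K => (if c ∈ univ.filter (fun c : Idx L R' =>
        site c ∈ region (R'.image (blk L)) (M * n) n J'.1) then (1 : ℝ) else 0) ≠ 0).Nonempty
    · obtain ⟨J₀, hJ₀⟩ := hne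
      have hx₀ := (Finset.mem_filter.1 (((cut_ind_bounds_line K J₀ c).2.2) (Finset.mem_filter.mp hJ₀).2)).2
      refine le_trans (Finset.card_le_card fun J' hJ' => ?_) (hadj J₀)
      rw [Finset.mem_filter] at hJ' ⊢
      exact ⟨Finset.mem_univ _, labelAdj_of_mem_region hρ hx₀
        (Finset.mem_filter.1 (((cut_ind_bounds_line K J' c).2.2) hJ'.2)).2⟩
    · rw [Finset.not_nonempty_iff_eq_empty.mp hne, Finset.card_empty]; positivity
  · by_cases hne : (univ.filter fun J' : Lab K => cut (M * n) J'.1 (site c).1 ≠ 0).Nonempty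
    · obtain ⟨J₀, hJ₀⟩ := hne
      have hx₀ : site c ∈ region (R'.image (blk L)) (M * n) n J₀.1 := mem_region_self_of_cut_ne_zero hW (Finset.mem_filter.mp hJ₀).2
      refine le_trans (Finset.card_le_card fun J' hJ' => ?_) (hadj J₀)
      rw [Finset.mem_filter] at hJ' ⊢
      exact ⟨Finset.mem_univ _, labelAdj_of_mem_region hρ hx₀ (mem_region_self_of_cut_ne_zero hW hJ'.2)⟩
    · rw [Finset.not_nonempty_iff_eq_empty.mp hne, Finset.card_empty]; positivity

/-! ### §3 The convergent expansion of `(𝒫♮(s))⁻¹` and the decay of `(twoCutoffLine s)⁻¹` -/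

include hn ha hs0 hs1 in
/-- the line is coercive with `σ♮`, for every `s ∈ [0,1]`. [folklore] -/
theorem extLine_coercive' (w : Idx L R' → ℝ) :
    lineSigma d L a * (w ⬝ᵥ w) ≤ w ⬝ᵥ (extLine (isBlockUnion_fine hR') n a s) *ᵥ w :=
  extLine_coercive hn hR' ha hs0 hs1 w

include ha in
/-- `0 < σ♮`. [folklore] -/
theorem lineSigma_pos : 0 < lineSigma d L a := by
  have hL : (0 : ℝ) < L := by exact_mod_cast (NeZero.one_le : 1 ≤ L)
  unfold lineSigma; positivity

include hn hM hR' hbox ha hs0 hs1 in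
/-- **THE REMAINDER IS SMALL, UNIFORMLY IN `s`**: `‖R(s)‖ ≤ 3^{d+1}·τ♮`. [folklore] -/
theorem l2_opNorm_remainder_line :
    ‖∑ J : Lab K, bPiece (extLine (isBlockUnion_fine hR') n a s) (fun c : Idx L R' => cut (M * n) J.1 (site c).1)
        (fun c => if c ∈ univ.filter (fun c : Idx L R' => site c ∈ region (R'.image (blk L)) (M * n) n J.1) then (1 : ℝ) else 0)
        (univ.filter fun c : Idx L R' => site c ∈ region (R'.image (blk L)) (M * n) n J.1)‖ ≤ (3 : ℝ) ^ (d + 1) * lineTau d L M a := by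
  classical
  obtain ⟨hW, hW2, hρ⟩ := scale_facts hn hM
  have hM0 : (0 : ℝ) < M := Nat.cast_pos.2 (by omega)
  have hα : 0 ≤ lineAlpha2 d L M := by unfold lineAlpha2; positivity
  have hβ : 0 ≤ lineBeta2 d L M a := by unfold lineBeta2; positivity
  have h := l2_opNorm_remainder_le (extLine (isBlockUnion_fine hR') n a s) (lineSigma_pos ha) (extLine_coercive' hn hR' ha hs0 hs1)
    (fun J : Lab K => fun c : Idx L R' => cut (M * n) J.1 (site c).1)
    (fun J c => if c ∈ univ.filter (fun c : Idx L R' => site c ∈ region (R'.image (blk L)) (M * n) n J.1) then (1 : ℝ) else 0)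
    (fun J => univ.filter fun c : Idx L R' => site c ∈ region (R'.image (blk L)) (M * n) n J.1)
    (cutoffOn_line K hn hR' hW) (fun J c => (cut_ind_bounds_line K J c).2.2) (fun J c => (cut_ind_bounds_line K J c).2.1) hα hβ
    (hcomm_line K hn hM hR' hbox ha hs0 hs1) (fun J => count_overlap_line K hρ _ (fun J c hc => (Finset.mem_filter.1 hc).2) J)
    fun c => (count_cover_line K hW hρ c).1
  refine h.trans (le_of_eq ?_)
  rw [lineTau, ← Real.sqrt_sq (by positivity : (0 : ℝ) ≤ (3 : ℝ) ^ (d + 1)), ← Real.sqrt_mul (by positivity)]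
  congr 1; push_cast; ring

include hn hM hR' hbox ha hs0 hs1 in
/-- **THE RANDOM-WALK EXPANSION OF `(𝒫♮(s))⁻¹` CONVERGES, UNIFORMLY IN `s ∈ [0,1]` AND IN THE MESH**: for `3^{d+1}·τ♮ < 1`,
`HasSum (k ↦ G₀(s)R(s)^k) (𝒫♮(s))⁻¹` in the `ℓ²`-operator norm — B4 (2.12)–(2.13) for the two-cutoff line at U = 1, one threshold
`M ≥ M₀(d,L,a)` for the whole line. [cite: Balaban1983RegularityDecay, (2.12)–(2.13) p.577, case A = 0] [folklore] -/
theorem hasSum_extLine_walk (hsmall : (3 : ℝ) ^ (d + 1) * lineTau d L M a < 1) :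
    HasSum (fun k : ℕ =>
      (∑ J : Lab K, aPiece (extLine (isBlockUnion_fine hR') n a s) (fun c : Idx L R' => cut (M * n) J.1 (site c).1)
        (fun c => if c ∈ univ.filter (fun c : Idx L R' => site c ∈ region (R'.image (blk L)) (M * n) n J.1) then (1 : ℝ) else 0)
        (univ.filter fun c : Idx L R' => site c ∈ region (R'.image (blk L)) (M * n) n J.1)) *
      (∑ J : Lab K, bPiece (extLine (isBlockUnion_fine hR') n a s) (fun c : Idx L R' => cut (M * n) J.1 (site c).1)
        (fun c => if c ∈ univ.filter (fun c : Idx L R' => site c ∈ region (R'.image (blk L)) (M * n) n J.1) then (1 : ℝ) else 0)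
        (univ.filter fun c : Idx L R' => site c ∈ region (R'.image (blk L)) (M * n) n J.1)) ^ k)
      (extLine (isBlockUnion_fine hR') n a s)⁻¹ := by
  obtain ⟨hW, -, -⟩ := scale_facts hn hM
  exact hasSum_walk_expansion _ (lineSigma_pos ha) (extLine_coercive' hn hR' ha hs0 hs1) _ _ _ (cutoffOn_line K hn hR' hW)
    (sum_cut_mul_ind_line K hbox hW) ((l2_opNorm_remainder_line K hn hM hR' hbox ha hs0 hs1).trans_lt hsmall)

include hn hM hR' hbox ha hs0 hs1 in
/-- **THE TWO-CUTOFF LINE'S PROPAGATOR DECAYS GEOMETRICALLY ACROSS `M`-CUBES, WITH CONSTANTS FREE OF `s` AND OF THE MESH**: for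
`3^{d+1}τ♮ < 1`, every `s ∈ [0,1]` and coarse sites `x, y` with `|x_μ − y_μ| ≥ (2N+3)Mn + n` in some coordinate (`N ≥ 1`),
`|(twoCutoffLine s)⁻¹(x,y)| ≤ 3^{d+1}·(min(σ♮,1))⁻¹·τ♮·3^{d+1}·(3^{d+1}τ♮)^{N−1}∕(1 − 3^{d+1}τ♮)` — B4 (2.22)∕(2.30)'s shape for the
K1-lin(s) line at U = 1 (read off on the coarse block of `(𝒫♮(s))⁻¹`, `NE7K1LinWalkLine.extLine_inv_inl_inl`).
[cite: Balaban1983RegularityDecay, (2.22) p.579, Corollary 2.3 (2.30) pp.580–581, case A = 0] [folklore] -/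
theorem twoCutoffLine_inv_entry_decay (hsmall : (3 : ℝ) ^ (d + 1) * lineTau d L M a < 1) (x y : ↥(R'.image (blk L))) {N : ℕ}
    (hN : 1 ≤ N) (hfar : ∃ μ, (((2 * N + 3) * (M * n) + n : ℕ) : ℤ) ≤ |x.1 μ - y.1 μ|) :
    |(twoCutoffLine (isBlockUnion_fine hR') n a s)⁻¹ x y| ≤
      (3 : ℝ) ^ (d + 1) * (1 / min (lineSigma d L a) 1) * lineTau d L M a * (3 : ℝ) ^ (d + 1) *
        ((3 : ℝ) ^ (d + 1) * lineTau d L M a) ^ (N - 1) / (1 - (3 : ℝ) ^ (d + 1) * lineTau d L M a) := by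
  classical
  obtain ⟨hW, hW2, hρ⟩ := scale_facts hn hM
  have hM0 : (0 : ℝ) < M := Nat.cast_pos.2 (by omega)
  have hα : 0 ≤ lineAlpha2 d L M := by unfold lineAlpha2; positivity
  have hβ : 0 ≤ lineBeta2 d L M a := by unfold lineBeta2; positivity
  obtain ⟨μ, hμ⟩ := hfar
  rw [← extLine_inv_inl_inl hn hR' ha hs0 x y]
  have h := inv_entry_decay (labPos K) (labPos_injective K) (extLine (isBlockUnion_fine hR') n a s) (lineSigma_pos ha)
    (extLine_coercive' hn hR' ha hs0 hs1) (fun J : Lab K => fun c : Idx L R' => cut (M * n) J.1 (site c).1)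
    (fun J c => if c ∈ univ.filter (fun c : Idx L R' => site c ∈ region (R'.image (blk L)) (M * n) n J.1) then (1 : ℝ) else 0)
    (fun J => univ.filter fun c : Idx L R' => site c ∈ region (R'.image (blk L)) (M * n) n J.1)
    (fun J J' hJJ' => disjoint_line K hρ hJJ') (cutoffOn_line K hn hR' hW) (sum_cut_mul_ind_line K hbox hW)
    zero_le_one (fun J c => (cut_ind_bounds_line K J c).1) (fun J c => (cut_ind_bounds_line K J c).2.2)
    (fun J c => (cut_ind_bounds_line K J c).2.1) hα hβ (hcomm_line K hn hM hR' hbox ha hs0 hs1)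
    (by rw [lineTau] at hsmall; exact hsmall) ((l2_opNorm_remainder_line K hn hM hR' hbox ha hs0 hs1).trans_lt hsmall)
    (Sum.inl x) (Sum.inl y) (count_cover_line K hW hρ (Sum.inl x)).2 hN
    (fun J hJ J' hJ' => ⟨μ, label_sep_of_far hW hJ (Finset.mem_filter.1 (((cut_ind_bounds_line K J' (Sum.inl y)).2.2) hJ')).2
      (by exact_mod_cast hμ)⟩)
  rw [lineTau]
  refine h.trans (le_of_eq ?_)
  push_cast
  ring

end Instance

end Summit.QuantumFields.BalabanUV.T4Continuum.NE7K1LinWalkLineWalk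

end
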